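import Summits.BirchSwinnertonDyer.Rank1Residual.ManinAdditive.MuThreeEdgeKodairaLaw
import Literature.NumberTheory.EllipticCurves.TorsionThreeNormalForm
import HarnessLib
import HarnessLib.Audit.Tags

/-!
# E-an-211 `MuThreeEdgeKodairaLaw` CUT INTO TWO STUBS — the Hessian-family Tate table (S1) and the Vélu transport (S2);
# the period-free comparison S1″ and the `27 ∣ N` restriction (cell `bsd-f2-manin`, seat `-an` g39, MEMO-an §83.9–§83.10; file E APPENDIX)

TYPER NOTE (typer g21, T-an-49 part 2).  SOURCE = HOME/an/g39/HessianMuThreeTable-an-g39.lean (file E) sha16 2be7cff94318fefe (458 l.; an: rc 0 ·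
0 · 0; BC7 4/4 CLEAN g39-bc7-e) — this tree file is file E's **APPENDIX** (namespace `…MuThreeEdgeKodaira.Hessian`, file E l.297–404)
VERBATIM, landed as a SIBLING of `MuThreeEdgeKodairaLaw.lean` (T-an-48, p736458 = file E's PART A′) rather than an append (an offered either;
the sibling keeps the theorem-bearing files under the 400-line cap).  Typer deltas: imports = `…ManinAdditive.MuThreeEdgeKodairaLaw` +
`Literature…TorsionThreeNormalForm` (for `WeierstrassCurve.kubertThree`) + HarnessLib(+Audit.Tags); file E's import of
`…Theorems.ManinLocalTwoThreeThreeIsogenyCovolumeLaw` (E-an-97, inside the `Theses.ManinLocalTwoThree` cone) is DROPPED together with PART F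
(`muThreeEdgeKodairaLawWild_of_comparison : S1″ → MuThreeEdgeKodairaLawWild`), a PROVER-ONLY target (`Theorems/ManinLocalTwoThreeMuThreeKodairaWild.lean`,
L-an-g39-3); the module docstring below is an's file-E APPENDIX summary.  CONTENT (an MEMO-an §83.9–§83.10): real defs `veluKubertThree`
(Vélu quotient of `kubertThree a₁ a₃` by (0,0)), `IsReducedAdditiveHessianParam`; `@[conjecture]` rows (an's tags) **S1 = E-an-218
`HessianVeluMinimalityTable`** (11-row Tate table at 3 over the Hessian/Vélu family — FINITE Tate content), **S1″ = E-an-220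
`MuThreeSourceDiscriminantComparison`** (PERIOD-FREE form of E-an-211), **`MuThreeEdgeKodairaLawWild`** (E-an-211 restricted to 27 ∣ N), **S2 =
E-an-219 `HessianMuThreeTransport`** (S1 ⟹ E-an-211, the Vélu dictionary); PROVED `muThreeEdgeKodairaLawWild_of_law`, `muThreeEdgeKodairaLaw_of_hessian`
(S1 → S2 → E-an-211), `veluKubertThree_Δ` (+ the 27a1 sanity `example`).  NOT IN PRINT as stated (packaging of [DokchitserDokchitser2015LocalInvariants]
Table 1 (†) + [GealyKlagsbrun2017] Thm 1 + Tate; an: «new combination, not a new mechanism»).  BC5 (an, exact local engines HOME/an/g39/census22/):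
S1 67 226/67 226 reduced pairs, 11 pure cells (hessian3-an-g39.py 7a05aef194ce0579, hessian3-1.txt dbd252f8e5357a21); S1″ 22 105/22 105 μ₃-edges
9 ∣ N < 5·10⁵ (mu3edge5-all.txt 025a675111980e70) and 7 810/7 810 N < 10⁵ (mu3disc-0.txt ce4f7302b658f885); 0 exceptions.  CHEAPEST FALSIFIER: one
reduced Hessian pair in an unsampled deep 3-adic cell with the wrong minimality step.  REFUTER: ref1 (R-an-76/77 scope) PENDING at landing.
Typer checks: 9 decl names fresh tree-wide; cite keys SilvermanATAEC1994 / BarriosRoy2022LocalData / GealyKlagsbrun2017 /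
DokchitserDokchitser2015LocalInvariants in references.bib; no instances, no notation.  PARTITION 0 · beyond-print theorem: no · bears_on:
stmt-BirchSwinnertonDyer-22968 (C3).  BSD is not proved by this; C3 OPEN.

an's summary (file E header, verbatim):
APPENDIX (namespace `…MuThreeEdgeKodaira.Hessian`) = the prover's entry point P-an-g39-2:
* `veluKubertThree a₁ a₃ = ⟨a₁, 0, a₃, −5a₁a₃, −a₁³a₃ − 7a₃²⟩` — Vélu's quotient of `WeierstrassCurve.kubertThree a₁ a₃ = ⟨a₁,0,a₃,0,0⟩` (tree,
  `Literature/…/TorsionThreeNormalForm.lean`) by its rational point `(0,0)` of order `3`; `Δ = a₃(a₁³ − 27a₃)³`; the dual isogeny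
  `veluKubertThree a₁ a₃ → kubertThree a₁ a₃` has `μ₃` kernel, and EVERY `μ₃`-edge over `ℚ` is of this form with `(a₁,a₃) ∈ ℤ²` 3-reduced.
* S1 `HessianVeluMinimalityTable` (E-an-218): for 3-reduced `(a₁,a₃)` with `3 ∣ a₁` (the additive fibre): the Vélu model is MINIMAL at `3`
  iff its Kodaira type is star (IV*, III*, II*), is ONE `u = 3` step from minimal iff the type is low (II, I₀*, Iₙ*), never of type III/IV,
  and the reduced Hessian model itself is minimal at `3`.  MACHINE EVIDENCE: full Tate at 3 on 67 226 reduced pairs (3-adic depth `3⁵`/`3⁷`,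
  units `|u| ≤ 40`): 0 exceptions, every `(v₃a₁, v₃a₃, v₃(a₁³−27a₃))` cell pure — the 11-row table of MEMO-an §83.9
  (HOME/an/g39/census22/hessian3-an-g39.py 7a05aef194ce0579, hessian3-1.txt dbd252f8e5357a21).  A finite Tate case analysis
  (pattern `Literature/…/KubertTateNineLocalDataThree.lean` + Table II bridges).
* S2 `HessianMuThreeTransport` (E-an-219): S1 ⟹ E-an-211 — the dictionary: a `μ₃`-edge `φ : W → W₂` of globally minimal curves is, up to
  `u ∈ {±1, ±3}` rescalings, the dual Vélu edge of `kubertThree a₁ a₃` (`exists_variableChange_eq_kubertThree_of_addOrderOf_eq_three`; `W₂`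
  has a rational point of order 3 generating `ker φ̂ = W[3]/μ₃ ≅ ℤ/3`), Vélu preserves the invariant differential and has lattice index 3
  (`LatticeIndexThreeVeluProofs`, `VeluQuotientCurveProofs`), so the Néron covolume ratio is `3^{±1}` according as the Vélu model is minimal
  or one step off (S1).  In print behind it: Dokchitser–Dokchitser 2015 Table 1 (†) and Gealy–Klagsbrun 2017 Thm 1 (tree:
  `dvd_and_not_dvd_neronScaling_of_padicValInt_minimalDiscriminantInt_lt_of_relIndex_eq`, `not_three_dvd_neronScaling_of_kodairaSymbolAt_three_eq_III`).
* S1″ `MuThreeSourceDiscriminantComparison` (E-an-220): the PERIOD-FREE form (star source ⟹ `ord₃Δ_min` drops along the edge; low source and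
  `27 ∣ N` ⟹ it rises; never III/IV) and `MuThreeEdgeKodairaLawWild` = E-an-211 restricted to `27 ∣ N(W)`; PART F PROVES
  `muThreeEdgeKodairaLawWild_of_comparison : S1″ → MuThreeEdgeKodairaLawWild` from the TREE THEOREM E-an-97
  `threeIsogenyCovolumeLawAtWildThree_holds` (`Theorems/ManinLocalTwoThreeThreeIsogenyCovolumeLaw.lean`) — so at `27 ∣ N` the only open
  input of E-an-211 is a statement about minimal discriminants (finite Tate content), no periods.
* `muThreeEdgeKodairaLaw_of_hessian : S1 → S2 → MuThreeEdgeKodairaLaw` (modus ponens; the seam is trivial by design, the content is in S1/S2).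
HONEST FRAMING: S1/S2 are `@[conjecture]` cell candidates; nothing here proves Manin's conjecture or BSD; E-an-211 is a new-combination
(μ₃/Kodaira packaging of DD + GK + Tate), not a new mechanism.  PARTITION 0 · beyond-print theorem: no · BSD is not proved by this.
-/

noncomputable section

open scoped Classical

/-! ## APPENDIX — E-an-211 cut into S1 (Hessian-family Tate table) and S2 (Vélu transport) -/

namespace Summit.BirchSwinnertonDyer.Rank1Residual.ManinAdditive.MuThreeEdgeKodaira.Hessian

open Summit.BirchSwinnertonDyer.Rank1Residual.ManinAdditive.MuThreeEdgeKodaira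
open WeierstrassCurve IsDedekindDomain
  Literature.NumberTheory.DiophantineGeometry
  Literature.NumberTheory.EllipticCurves Literature.NumberTheory.EllipticCurves.ModularForms
  Summit.BirchSwinnertonDyer.Rank1Residual.Additive
  Summit.BirchSwinnertonDyer.Rank1Residual.ManinAdditive
  Summit.BirchSwinnertonDyer.Rank1Residual.ManinAdditive.CuspidalKummer
  Summit.BirchSwinnertonDyer.Rank1Residual.ManinAdditive.CuspidalKummerThree
  Summit.BirchSwinnertonDyer.Rank1Residual.ManinAdditive.ThreeIsogenyKernel

/-- Vélu's quotient of the Hessian / Kubert curve `kubertThree a₁ a₃ : y² + a₁xy + a₃y = x³` by its rational point `(0,0)` of order 3: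
`y² + a₁xy + a₃y = x³ − 5a₁a₃x − a₁³a₃ − 7a₃²` (`Δ = a₃(a₁³ − 27a₃)³`); the dual isogeny back to `kubertThree a₁ a₃` has `μ₃` kernel. [folklore] -/
def veluKubertThree (a₁ a₃ : ℤ) : WeierstrassCurve ℚ :=
  ⟨a₁, 0, a₃, -5 * a₁ * a₃, -(a₁ ^ 3 * a₃) - 7 * a₃ ^ 2⟩

/-- `(a₁, a₃) ∈ ℤ²` is a 3-REDUCED Hessian parameter on the ADDITIVE fibre: `a₃ ≠ 0`, `a₁³ ≠ 27a₃` (elliptic), not (`3 ∣ a₁` and `27 ∣ a₃`)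
(else rescale by `u = 3`), and `3 ∣ a₁` (the fibre where `veluKubertThree a₁ a₃` is additive at 3; `3 ∤ a₁` is good or multiplicative). [folklore] -/
def IsReducedAdditiveHessianParam (a₁ a₃ : ℤ) : Prop :=
  a₃ ≠ 0 ∧ a₁ ^ 3 ≠ 27 * a₃ ∧ (3 : ℤ) ∣ a₁ ∧ ¬ (27 : ℤ) ∣ a₃

/-- **S1 = E-an-218 `HessianVeluMinimalityTable` (crux-sized but FINITE: a Tate case analysis).**  For a 3-reduced additive Hessian parameter:
(i) the Vélu model is minimal at 3 (`v₃Δ(model) = ord₃Δ_min`) iff its Kodaira type at 3 is IV*, III* or II*; (ii) it is exactly one `u = 3`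
step off minimal (`v₃Δ(model) = ord₃Δ_min + 12`) iff the type is II or Iₙ* (`n ≥ 0`); (iii) the type is never III or IV; (iv) the reduced
Hessian model `kubertThree a₁ a₃` is minimal at 3.  Census: 67 226/67 226 reduced pairs (hessian3-an-g39.py), 11 pure cells (MEMO-an §83.9);
Cremona side 22 105/22 105 μ₃-edges `9 ∣ N < 5·10⁵`.  Why it might fail: an unsampled deep 3-adic cell (all cells up to depth 3⁵/3⁷ are pure;
the outcome provably depends only on finitely many 3-adic digits).  [cite: SilvermanATAEC1994, IV.9.4 (Tate's algorithm)]
[cite: BarriosRoy2022LocalData, Thm. 3.8 (T = C₃ rows: the kubertThree side)] -/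
@[conjecture]
def HessianVeluMinimalityTable : Prop :=
  ∀ a₁ a₃ : ℤ, IsReducedAdditiveHessianParam a₁ a₃ →
    (IsStarKodairaAtThree (veluKubertThree a₁ a₃) ↔
        padicValInt 3 (a₃ * (a₁ ^ 3 - 27 * a₃) ^ 3) = (veluKubertThree a₁ a₃).ordMinimalDiscriminant (placeOf 3)) ∧
    (IsLowKodairaAtThree (veluKubertThree a₁ a₃) ↔
        padicValInt 3 (a₃ * (a₁ ^ 3 - 27 * a₃) ^ 3) = (veluKubertThree a₁ a₃).ordMinimalDiscriminant (placeOf 3) + 12) ∧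
    (veluKubertThree a₁ a₃).kodairaSymbolAt (placeOf 3) ≠ .III ∧ (veluKubertThree a₁ a₃).kodairaSymbolAt (placeOf 3) ≠ .IV ∧
    padicValInt 3 (a₃ ^ 3 * (a₁ ^ 3 - 27 * a₃)) =
      (WeierstrassCurve.kubertThree (a₁ : ℚ) (a₃ : ℚ)).ordMinimalDiscriminant (placeOf 3)

/-- **S1″ = E-an-220 `MuThreeSourceDiscriminantComparison` (PERIOD-FREE form of E-an-211; crux-sized, finite Tate content).**  Along a
`μ₃`-edge `φ : W → W₂` of globally minimal curves with `W` additive at 3: the source type is star or low (never III / IV); if STAR then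
`ord₃Δ_min(W₂) < ord₃Δ_min(W)`; if LOW and `27 ∣ N(W)` then `ord₃Δ_min(W) < ord₃Δ_min(W₂)` (at `9 ∥ N` the low types I₀*, Iₙ* are potentially
ordinary / multiplicative and the comparison is `=` resp. `>`: Hessian rows `(v₃a₁, v₃a₃, m) = (1,0,6)`, `(1,0,≥7)`).  Follows from S1 + the
lattice-free half of S2 (every `μ₃`-edge is a 3-reduced Hessian pair; `ord₃Δ_min` of both ends read off the table: `δ(W₂) = 3v₃a₃ + m`,
`δ(W) = v₃a₃ + 3m − 12e`).  Census: 22 105/22 105 μ₃-edges `9 ∣ N < 5·10⁵` (mu3edge5-all.txt 025a675111980e70).  Why it might fail: as S1.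
[cite: GealyKlagsbrun2017, Thm. 1 (m(E) ≠ m(E′) at additive potentially supersingular p, K/ℚ_p unramified)]
[cite: DokchitserDokchitser2015LocalInvariants, Table 1] -/
@[conjecture]
def MuThreeSourceDiscriminantComparison : Prop :=
  ∀ (W W₂ : WeierstrassCurve ℚ) [W.IsElliptic] [W.IsGloballyMinimal] [W₂.IsElliptic] [W₂.IsGloballyMinimal]
    (φ : Isogeny W W₂), φ.degree = 3 → HasMuThreeKernel φ → (W.kodairaSymbolAt (placeOf 3)).IsAdditive →
    (IsStarKodairaAtThree W ∨ IsLowKodairaAtThree W) ∧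
    (IsStarKodairaAtThree W → padicValInt 3 W₂.minimalDiscriminantInt < padicValInt 3 W.minimalDiscriminantInt) ∧
    (IsLowKodairaAtThree W → 3 ^ 3 ∣ W.conductorNorm ℤ →
        padicValInt 3 W.minimalDiscriminantInt < padicValInt 3 W₂.minimalDiscriminantInt)

/-- **E-an-211 restricted to `27 ∣ N(W)` (`MuThreeEdgeKodairaLawWild`)** — the case that bears on `ManinPrimeToThreeAtNine` beyond `9 ∥ N`;
PROVED below (PART F) from S1″ and the TREE THEOREM E-an-97 `threeIsogenyCovolumeLawAtWildThree_holds`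
(`Theorems/ManinLocalTwoThreeThreeIsogenyCovolumeLaw.lean`: rise/drop of `ord₃Δ_min` decides the Néron covolume ratio `3^{∓1}` at `27 ∣ N`).
[cite: GealyKlagsbrun2017, Thm. 1] -/
@[conjecture]
def MuThreeEdgeKodairaLawWild : Prop :=
  ∀ (W W₂ : WeierstrassCurve ℚ) [W.IsElliptic] [W.IsGloballyMinimal] [W₂.IsElliptic] [W₂.IsGloballyMinimal]
    (φ : Isogeny W W₂) (L L₂ : PeriodPair),
    φ.degree = 3 → HasMuThreeKernel φ →
    IsNeronLatticeOf (W.baseChange ℂ) L → IsNeronLatticeOf (W₂.baseChange ℂ) L₂ →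
    (W.kodairaSymbolAt (placeOf 3)).IsAdditive → 3 ^ 3 ∣ W.conductorNorm ℤ →
    (ZLattice.covolume L₂.lattice = 3 * ZLattice.covolume L.lattice ↔ IsStarKodairaAtThree W) ∧
    (3 * ZLattice.covolume L₂.lattice = ZLattice.covolume L.lattice ↔ IsLowKodairaAtThree W) ∧
    W.kodairaSymbolAt (placeOf 3) ≠ .III ∧ W.kodairaSymbolAt (placeOf 3) ≠ .IV

/-- The unrestricted law gives the restricted one (bookkeeping). [folklore] -/
theorem muThreeEdgeKodairaLawWild_of_law (h : MuThreeEdgeKodairaLaw) : MuThreeEdgeKodairaLawWild := by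
  intro W W₂ _ _ _ _ φ L L₂ hφ hμ hL hL₂ hadd _
  exact h W W₂ φ L L₂ hφ hμ hL hL₂ hadd

/-- **S2 = E-an-219 `HessianMuThreeTransport` (support/M-sized: the Vélu dictionary).**  The family table S1 implies the μ₃-edge Kodaira law
E-an-211 for arbitrary globally minimal `W, W₂`, `φ` of degree 3 with `μ₃` kernel and Néron period pairs: `W₂` carries a rational point of
order 3 generating `ker φ̂` (Cartier duality), hence `W₂ ≅ kubertThree a₁ a₃` with `(a₁,a₃)` 3-reduced (`exists_variableChange_eq_kubertThree_of_addOrderOf_eq_three`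
+ integral rescaling), `W ≅ veluKubertThree a₁ a₃` up to `u ∈ {±1, ±3}` (uniqueness of the quotient by a given kernel), Vélu preserves the
invariant differential and has period-lattice index 3, so `covol(L₂)/covol(L) = 3` iff the Vélu model is minimal, `= 1/3` iff it is one step off.
Why it might fail: it cannot mathematically; the risk is Lean plumbing (isogeny uniqueness up to isomorphism, Néron lattice under `u`-rescaling).
[cite: DokchitserDokchitser2015LocalInvariants, Table 1 and (†)] [cite: GealyKlagsbrun2017, Thm. 1] -/
@[conjecture]
def HessianMuThreeTransport : Prop :=
  HessianVeluMinimalityTable → MuThreeEdgeKodairaLaw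

/-- E-an-211 from the two stubs (modus ponens; the mathematical content is S1 = table, S2 = transport). [folklore] -/
theorem muThreeEdgeKodairaLaw_of_hessian (hS1 : HessianVeluMinimalityTable) (hS2 : HessianMuThreeTransport) :
    MuThreeEdgeKodairaLaw :=
  hS2 hS1

/-- Sanity: the discriminant of the Vélu model is `a₃(a₁³ − 27a₃)³` (so the `padicValInt` in S1 is `v₃` of the model discriminant). [folklore] -/
theorem veluKubertThree_Δ (a₁ a₃ : ℤ) :
    (veluKubertThree a₁ a₃).Δ = (a₃ : ℚ) * ((a₁ : ℚ) ^ 3 - 27 * a₃) ^ 3 := by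
  simp only [veluKubertThree, WeierstrassCurve.Δ, WeierstrassCurve.b₂, WeierstrassCurve.b₄, WeierstrassCurve.b₆, WeierstrassCurve.b₈]
  ring

/-- Sanity: `27a1`'s edge.  `kubertThree 0 1 : y² + y = x³` is 27a3 and `veluKubertThree 0 1 = ⟨0,0,1,0,−7⟩ : y² + y = x³ − 7` is 27a1
(Cremona), the optimal curve of conductor 27, of type IV* at 3 with `v₃Δ = v₃(−27³·…)`: here `Δ(model) = 1·(0 − 27)³ = −3⁹`, `v₃ = 9 = ord₃Δ_min(27a1)`
— the STAR/minimal row `(a₁ = 0, v₃a₃ = 0, m = 3)` of the table; the μ₃-edge 27a1 → 27a3 ASCENDS (MEMO-an §82.3: 27a1 ⊂ Σ-stratum). [folklore] -/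
example : (veluKubertThree 0 1).Δ = -(3 : ℚ) ^ 9 := by
  rw [veluKubertThree_Δ]; norm_num

end Summit.BirchSwinnertonDyer.Rank1Residual.ManinAdditive.MuThreeEdgeKodaira.Hessian

end
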